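import Summits.QuantumFields.YangMills.Theorems.BalabanLadderNTMirrorSplitTorus
import Summits.QuantumFields.YangMills.Theorems.BalabanLadderUVSeamRecFloorsEngineOfBareMirror
import HarnessLib

/-!
# Crux `UVSeamRec` (stmt-QuantumFields-20043), stub `stub_floorsEngine` (S-B), conjunct 2: CHECK-LEMMA — the
# registered statement from {BL6, LOCALISED MIRROR FLOOR (LMF) + cross bound (LXB) over a Θ'-equivariant block
# σ-algebra, clause (ii)} at `rF`

Helper file (`--supports stmt-QuantumFields-20043`; owner RULINGS R78/R87) of the fleet lead `ym-spine-19353-p1`,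
sequel of `…NTMirrorSplit` / `…NTMirrorSplitTorus` (general `(G, r)`): the asymptotic packaging along a unit map and
the specialisation «last file» to `(SU(2), rF = fundamentalLatticeRep 2, a/uRec → c₀)`.
WHICH CLAUSE IT SUPPLIES: conjunct 2 (two-point floor) of the REGISTERED `UVSeamRec.stub_floorsEngine` through the
R87 residual MF(4ε), with MF itself DISCHARGED from the allocation A2 of card `block-sigma-algebra-mirror-split`
(crux-ideate seat `ym-cruxidea-19353-1`): per coupling `β ≥ β₅` and torus `2L+1` with `Λ₅ ≤ aβ·L`,

* a `Θ'`-EQUIVARIANT coarse-graining `π_{β,L}` of the torus gauge fields into a measurable space `Y β L`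
  (`π(Θ'U) = θ(πU)`; the card PINS `π` = Bałaban's last-scale Θ'-symmetrised block-average field — here a PARAMETER);
* a LOCALISER `h_{β,L}`: bounded, `σ(π_{β,L})`-measurable, an observable of the closed positive half, centred
  `∫ h dμ_T = E_T[Ṽ_v]` (canonical: `h = E_T[Ṽ_v∘lift | positive-half blocks]`);
* (LMF) `X ≤ Cov_T(h∘Θ', h)` — a mirror floor for ONE bounded COARSE positive-half functional;
* (LXB) `|Cov_T(h∘Θ', g − h)| ≤ ρ`, `g = E_T[Ṽ_v∘lift | σ(π)]` — one-observable localisation; and `4ε + 2ρ ≤ X`.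

By `MirrorSplit.torus_mirror_floor_of_localiser` (the conditional fluctuation term is an RP square and needs no
bound) these give MF(4ε) on every such torus for `β ≥ max β₅ 0`; the rest is p517197/p518416:

* `bareFloors_of_localisedMirror` — {π, h, (LMF), (LXB)} family ⇒ the MF(4ε) family (general `(G, r, a)`);
* `Q2_floor_of_localisedMirror` / `floorsTwoPoint_of_localisedMirror` — {RBLΔ, the above} ⇒ `Q2(θv, v) ≥ ε` for all
  large couplings and tori / the compact-witness two-point conjunct (general `(G, r, a)`);
* `stubFloorsEngine_of_localisedMirror_rF` — the REGISTERED v5(α)/v4-F `stub_floorsEngine` statement VERBATIM from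
  {unit clauses, BL6, the localised-mirror clauses, clause (ii) supplier} = `MarkovMirrorFloors.stubFloorsEngine_of_bareFloor_rF`
  (p518416) with its (MF) conjunct replaced.

HONEST FRAMING.  Bookkeeping on a conditional chain: (LMF) for the pinned block-field localiser (tree-level Wick
positivity in the running coupling, NOT in print as a lower bound) and (LXB) (quasi-locality of Bałaban conditional
expectations), BL6/FBL6 and clause (ii) are engine-grade OPEN (crux `NT`; barrier `PerturbativeInvisibility`);
nothing `SU(2)`-specific beyond the instantiation; no `UV`, no two-point ceiling is consumed; not a claim about NT or
the gap. [cite: OsterwalderSeiler1978, §2; GlimmJaffe1987, §6.1]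
-/

set_option autoImplicit false

noncomputable section

open scoped SchwartzMap
open MeasureTheory Filter Topology
open Literature.MathematicalPhysics.QuantumFieldTheory Literature.MathematicalPhysics.QuantumLattice
open Literature.Probability.LatticeModels
open Summit.QuantumFields.YangMills.Cruxes.OSLegsFromFemtoAndGap.DlrCollarTransfer
open Summit.QuantumFields.YangMills.Cruxes.NT.MarkovMirror
open Summit.QuantumFields.YangMills.Cruxes.NT.MirrorSplit (torus_mirror_floor_of_localiser)

namespace Summit.QuantumFields.YangMills.Cruxes.UVSeamRec.MirrorSplitFloors

/-! ## §1 Along a unit map: the localised-mirror family gives the MF(4ε) family (general `(G, r, a)`) -/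

section General

variable (G : Type) [Group G] [TopologicalSpace G] [IsTopologicalGroup G] [CompactSpace G]
  [MeasurableSpace G] [BorelSpace G] (r : LatticeRep G)

/-- **MF(4ε) on every large torus from (LMF) + (LXB), along a unit map** (general `(G, r, a)`).  A unit map `a > 0`;
for `β ≥ β₅` a cube `Q_β = (c β, b β)` at times `≥ 1` of physical size `(|c β j| + b β + 3)·aβ ≤ Λ₅` and a weight `w β`
on its sites (think `w β y = v(aβ·y)`), `Ṽ_β = ∑_{y ∈ Q_β} w β y · dens_y`; per coupling and torus `2L+1` with
`Λ₅ ≤ aβ·L`: a `Θ'`-equivariant measurable coarse-graining `π β L` (values in `Y β L`, reflection `θ β L`), a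
LOCALISER `hl β L` — `σ(π β L)`-measurable, bounded, an observable of the closed positive half, centred
`∫ hl β L dμ_T = E_T[Ṽ_β]` — with (LMF) `X ≤ Cov_T(hl∘Θ', hl)` and (LXB) `|Cov_T(hl∘Θ', g − hl)| ≤ ρ`,
`g = E_T[Ṽ_β∘lift | σ(π β L)]`; and `4ε + 2ρ ≤ X`.  Then MF(4ε) `4ε ≤ Cov_T(Ṽ_β∘Θ₀, Ṽ_β)` on every such torus for
`β ≥ max β₅ 0` — the hypothesis shape of `MarkovMirror.Q2_floor_of_bareFloor_chiral` (p517197).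
[cite: OsterwalderSeiler1978, §2] -/
theorem bareFloors_of_localisedMirror (a : ℝ → ℝ) (ha₀ : ∀ β, 0 < a β) {ε X ρ : ℝ} (hbud : 4 * ε + 2 * ρ ≤ X)
    {β₅ Λ₅ : ℝ} (c : ℝ → (Fin 4 → ℤ)) (b : ℝ → ℕ) (w : ℝ → (Fin 4 → ℤ) → ℝ)
    (hgeom : ∀ β, β₅ ≤ β → 1 ≤ c β 0 ∧ ∀ j : Fin 4, (|((c β j : ℤ) : ℝ)| + (b β : ℝ) + 3) * a β ≤ Λ₅)
    {Y : ℝ → ℕ → Type} [∀ β L, MeasurableSpace (Y β L)]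
    (π : ∀ (β : ℝ) (L : ℕ), GaugeConfig 4 (2 * L + 1) G → Y β L) (θ : ∀ (β : ℝ) (L : ℕ), Y β L → Y β L)
    (hπ : ∀ (β : ℝ) (L : ℕ), Measurable (π β L) ∧ Measurable (θ β L) ∧
      ∀ U, π β L (GaugeConfig.negReflect U) = θ β L (π β L U))
    (hl : ∀ (β : ℝ) (L : ℕ), GaugeConfig 4 (2 * L + 1) G → ℝ)
    (hloc : ∀ β, β₅ ≤ β → ∀ L : ℕ, Λ₅ ≤ a β * L →
      Measurable[MeasurableSpace.comap (π β L) inferInstance] (hl β L) ∧ (∃ K : ℝ, ∀ U, |hl β L U| ≤ K) ∧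
      DependsOn (hl β L) {e : Edge 4 (2 * L + 1) | (e.1 0).val ≤ L ∧ ((e.1.shift e.2) 0).val ≤ L} ∧
      ∫ U, hl β L U ∂(wilsonMeasure (d := 4) (L := 2 * L + 1) r.ρ β) =
        torusE G r β L (fun V => ∑ y ∈ cubeSites (c β) (b β), w β y * dens G r y V))
    (hLMF : ∀ β, β₅ ≤ β → ∀ L : ℕ, Λ₅ ≤ a β * L →
      X ≤ (∫ U, hl β L U.negReflect * hl β L U ∂(wilsonMeasure (d := 4) (L := 2 * L + 1) r.ρ β)) -
        (∫ U, hl β L U.negReflect ∂(wilsonMeasure (d := 4) (L := 2 * L + 1) r.ρ β)) *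
          (∫ U, hl β L U ∂(wilsonMeasure (d := 4) (L := 2 * L + 1) r.ρ β)))
    (hLXB : ∀ β, β₅ ≤ β → ∀ L : ℕ, Λ₅ ≤ a β * L →
      |(∫ U, hl β L U.negReflect *
            (((wilsonMeasure (d := 4) (L := 2 * L + 1) r.ρ β)[fun U =>
                ∑ y ∈ cubeSites (c β) (b β), w β y * dens G r y (torusLift (2 * L + 1) U)|
                MeasurableSpace.comap (π β L) inferInstance]) U - hl β L U)
            ∂(wilsonMeasure (d := 4) (L := 2 * L + 1) r.ρ β)) -
          (∫ U, hl β L U.negReflect ∂(wilsonMeasure (d := 4) (L := 2 * L + 1) r.ρ β)) *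
            (∫ U, (((wilsonMeasure (d := 4) (L := 2 * L + 1) r.ρ β)[fun U =>
                ∑ y ∈ cubeSites (c β) (b β), w β y * dens G r y (torusLift (2 * L + 1) U)|
                MeasurableSpace.comap (π β L) inferInstance]) U - hl β L U)
              ∂(wilsonMeasure (d := 4) (L := 2 * L + 1) r.ρ β))| ≤ ρ) :
    ∀ β : ℝ, max β₅ 0 ≤ β → ∀ L : ℕ, Λ₅ ≤ a β * L →
      4 * ε ≤ torusE G r β L (fun V =>
          (∑ y ∈ cubeSites (c β) (b β), w β y * dens G r y (cfgReflect V)) *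
            ∑ y ∈ cubeSites (c β) (b β), w β y * dens G r y V) -
        torusE G r β L (fun V => ∑ y ∈ cubeSites (c β) (b β), w β y * dens G r y (cfgReflect V)) *
          torusE G r β L (fun V => ∑ y ∈ cubeSites (c β) (b β), w β y * dens G r y V) := by
  intro β hβ L hL
  have hβ5 : β₅ ≤ β := le_of_max_le_left hβ
  have hβ0 : 0 ≤ β := le_of_max_le_right hβ
  obtain ⟨hc1, hsize⟩ := hgeom β hβ5
  obtain ⟨hcL, -⟩ := torusFit_of_geom (ha₀ β) hsize hL
  obtain ⟨hπm, hθm, heq⟩ := hπ β L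
  obtain ⟨hhm, ⟨K, hK⟩, hdep, hcent⟩ := hloc β hβ5 L hL
  obtain ⟨MW, hMW⟩ := exists_abs_cubeSmear_le G r (c β) (b β) (w β)
  have hWc := continuous_cubeSmear G r (c β) (b β) (w β)
  obtain ⟨SW, hWS, hSW⟩ := exists_isCylinder_cubeSmear G r (c β) (b β) (w β)
  have hL1 : 1 ≤ L := by
    have h0 : (0 : ℤ) ≤ (b β : ℤ) := Int.natCast_nonneg _
    have : (1 : ℤ) ≤ (L : ℤ) := by linarith
    exact_mod_cast this
  have hwin : ∀ e ∈ SW, 0 ≤ e.1 0 ∧ e.1 0 + 1 ≤ (L : ℤ) := fun e he =>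
    ⟨by linarith [(hSW e he 0).1], by linarith [(hSW e he 0).2]⟩
  have key := torus_mirror_floor_of_localiser G r hβ0 hL1 hπm hθm heq hWc hMW hWS hwin hhm hK hdep hcent
  have h1 := hLMF β hβ5 L hL
  have h2 := hLXB β hβ5 L hL
  beta_reduce at key
  linarith [key, h1, h2]

/-- **`Q2(θv, v) ≥ ε` for all large couplings and tori from {RBLΔ, π, h, (LMF), (LXB)}** (general `(G, r, a)`):
the hypotheses of `MarkovMirror.Q2_floor_of_bareFloor_chiral` (p517197) with the bare mirror floor (MF) REPLACED by
the localised-mirror clauses.  `ε > 0`, `4ε + 2ρ ≤ X`; conclusion for `β ≥ max (max β₅ 0) 0`.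
[cite: OsterwalderSeiler1978, §2] -/
theorem Q2_floor_of_localisedMirror (a : ℝ → ℝ) (ha₀ : ∀ β, 0 < a β)
    (v : 𝓢(EuclideanSpace ℝ (Fin 4), ℝ)) {ε X ρ : ℝ} (hε : 0 < ε) (hbud : 4 * ε + 2 * ρ ≤ X) {β₅ Λ₅ : ℝ}
    (c : ℝ → (Fin 4 → ℤ)) (b : ℝ → ℕ) (p' : ℝ → ℝ)
    (hgeom : ∀ β, β₅ ≤ β → 1 ≤ c β 0 ∧ ∀ j : Fin 4, (|((c β j : ℤ) : ℝ)| + (b β : ℝ) + 3) * a β ≤ Λ₅)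
    (hsupp : ∀ β, β₅ ≤ β → ∀ x : Fin 4 → ℤ, v (a β • siteToE x) ≠ 0 →
      x ∈ cubeSites (c β) (b β) ∧ 2 ≤ depth (c β) (b β) x)
    (hΔ : ∀ β, β₅ ≤ β → ∀ ζ,
      |kerE G r β (c β) (b β) ζ (fun V => ∑ x ∈ cubeSites (c β) (b β), v (a β • siteToE x) *
          ∑ q : {q : Fin 4 × Fin 4 // q.1 < q.2}, plane G r q.1 (if q.1.1 = 0 then x - Pi.single 0 1 else x) V) -
        kerE G r β (c β) (b β) ζ (fun V => ∑ y ∈ cubeSites (c β) (b β), v (a β • siteToE y) * dens G r y V) -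
        p' β| ≤ Real.sqrt ε / 2)
    {Y : ℝ → ℕ → Type} [∀ β L, MeasurableSpace (Y β L)]
    (π : ∀ (β : ℝ) (L : ℕ), GaugeConfig 4 (2 * L + 1) G → Y β L) (θ : ∀ (β : ℝ) (L : ℕ), Y β L → Y β L)
    (hπ : ∀ (β : ℝ) (L : ℕ), Measurable (π β L) ∧ Measurable (θ β L) ∧
      ∀ U, π β L (GaugeConfig.negReflect U) = θ β L (π β L U))
    (hl : ∀ (β : ℝ) (L : ℕ), GaugeConfig 4 (2 * L + 1) G → ℝ)
    (hloc : ∀ β, β₅ ≤ β → ∀ L : ℕ, Λ₅ ≤ a β * L →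
      Measurable[MeasurableSpace.comap (π β L) inferInstance] (hl β L) ∧ (∃ K : ℝ, ∀ U, |hl β L U| ≤ K) ∧
      DependsOn (hl β L) {e : Edge 4 (2 * L + 1) | (e.1 0).val ≤ L ∧ ((e.1.shift e.2) 0).val ≤ L} ∧
      ∫ U, hl β L U ∂(wilsonMeasure (d := 4) (L := 2 * L + 1) r.ρ β) =
        torusE G r β L (fun V => ∑ y ∈ cubeSites (c β) (b β), v (a β • siteToE y) * dens G r y V))
    (hLMF : ∀ β, β₅ ≤ β → ∀ L : ℕ, Λ₅ ≤ a β * L →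
      X ≤ (∫ U, hl β L U.negReflect * hl β L U ∂(wilsonMeasure (d := 4) (L := 2 * L + 1) r.ρ β)) -
        (∫ U, hl β L U.negReflect ∂(wilsonMeasure (d := 4) (L := 2 * L + 1) r.ρ β)) *
          (∫ U, hl β L U ∂(wilsonMeasure (d := 4) (L := 2 * L + 1) r.ρ β)))
    (hLXB : ∀ β, β₅ ≤ β → ∀ L : ℕ, Λ₅ ≤ a β * L →
      |(∫ U, hl β L U.negReflect *
            (((wilsonMeasure (d := 4) (L := 2 * L + 1) r.ρ β)[fun U =>
                ∑ y ∈ cubeSites (c β) (b β), v (a β • siteToE y) * dens G r y (torusLift (2 * L + 1) U)|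
                MeasurableSpace.comap (π β L) inferInstance]) U - hl β L U)
            ∂(wilsonMeasure (d := 4) (L := 2 * L + 1) r.ρ β)) -
          (∫ U, hl β L U.negReflect ∂(wilsonMeasure (d := 4) (L := 2 * L + 1) r.ρ β)) *
            (∫ U, (((wilsonMeasure (d := 4) (L := 2 * L + 1) r.ρ β)[fun U =>
                ∑ y ∈ cubeSites (c β) (b β), v (a β • siteToE y) * dens G r y (torusLift (2 * L + 1) U)|
                MeasurableSpace.comap (π β L) inferInstance]) U - hl β L U)
              ∂(wilsonMeasure (d := 4) (L := 2 * L + 1) r.ρ β))| ≤ ρ) :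
    ∀ β : ℝ, max (max β₅ 0) 0 ≤ β → ∀ L : ℕ, Λ₅ ≤ a β * L → ε ≤ Q2 G r β L (a β) (thetaTest 4 v) v :=
  Q2_floor_of_bareFloor_chiral G r a ha₀ v hε (β₅ := max β₅ 0) (Λ₅ := Λ₅) c b p'
    (fun β hβ => hgeom β (le_of_max_le_left hβ)) (fun β hβ => hsupp β (le_of_max_le_left hβ))
    (fun β hβ ζ => hΔ β (le_of_max_le_left hβ) ζ)
    (bareFloors_of_localisedMirror G r a ha₀ hbud c b (fun β y => v (a β • siteToE y)) hgeom π θ hπ hl hloc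
      hLMF hLXB)

/-- **The two-point conjunct of `UVSeamRec.stub_floorsEngine` from {RBLΔ, π, h, (LMF), (LXB)}** (compact support
of the test function recorded; general `(G, r, a)` — at `(SU(2), rF, a ≍ c₀·uRec)` it is the registered conjunct):
`MarkovMirror.floorsTwoPoint_of_bareFloor_chiral` with (MF) replaced by the localised-mirror clauses.
[cite: OsterwalderSeiler1978, §2] -/
theorem floorsTwoPoint_of_localisedMirror (a : ℝ → ℝ) (ha₀ : ∀ β, 0 < a β)
    (v : 𝓢(EuclideanSpace ℝ (Fin 4), ℝ)) (hvK : HasCompactSupport (v : EuclideanSpace ℝ (Fin 4) → ℝ))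
    (hv : tsupport (v : EuclideanSpace ℝ (Fin 4) → ℝ) ⊆ {y | 0 < y 0})
    {ε X ρ : ℝ} (hε : 0 < ε) (hbud : 4 * ε + 2 * ρ ≤ X) {β₅ Λ₅ : ℝ}
    (c : ℝ → (Fin 4 → ℤ)) (b : ℝ → ℕ) (p' : ℝ → ℝ)
    (hgeom : ∀ β, β₅ ≤ β → 1 ≤ c β 0 ∧ ∀ j : Fin 4, (|((c β j : ℤ) : ℝ)| + (b β : ℝ) + 3) * a β ≤ Λ₅)
    (hsupp : ∀ β, β₅ ≤ β → ∀ x : Fin 4 → ℤ, v (a β • siteToE x) ≠ 0 →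
      x ∈ cubeSites (c β) (b β) ∧ 2 ≤ depth (c β) (b β) x)
    (hΔ : ∀ β, β₅ ≤ β → ∀ ζ,
      |kerE G r β (c β) (b β) ζ (fun V => ∑ x ∈ cubeSites (c β) (b β), v (a β • siteToE x) *
          ∑ q : {q : Fin 4 × Fin 4 // q.1 < q.2}, plane G r q.1 (if q.1.1 = 0 then x - Pi.single 0 1 else x) V) -
        kerE G r β (c β) (b β) ζ (fun V => ∑ y ∈ cubeSites (c β) (b β), v (a β • siteToE y) * dens G r y V) -
        p' β| ≤ Real.sqrt ε / 2)
    {Y : ℝ → ℕ → Type} [∀ β L, MeasurableSpace (Y β L)]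
    (π : ∀ (β : ℝ) (L : ℕ), GaugeConfig 4 (2 * L + 1) G → Y β L) (θ : ∀ (β : ℝ) (L : ℕ), Y β L → Y β L)
    (hπ : ∀ (β : ℝ) (L : ℕ), Measurable (π β L) ∧ Measurable (θ β L) ∧
      ∀ U, π β L (GaugeConfig.negReflect U) = θ β L (π β L U))
    (hl : ∀ (β : ℝ) (L : ℕ), GaugeConfig 4 (2 * L + 1) G → ℝ)
    (hloc : ∀ β, β₅ ≤ β → ∀ L : ℕ, Λ₅ ≤ a β * L →
      Measurable[MeasurableSpace.comap (π β L) inferInstance] (hl β L) ∧ (∃ K : ℝ, ∀ U, |hl β L U| ≤ K) ∧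
      DependsOn (hl β L) {e : Edge 4 (2 * L + 1) | (e.1 0).val ≤ L ∧ ((e.1.shift e.2) 0).val ≤ L} ∧
      ∫ U, hl β L U ∂(wilsonMeasure (d := 4) (L := 2 * L + 1) r.ρ β) =
        torusE G r β L (fun V => ∑ y ∈ cubeSites (c β) (b β), v (a β • siteToE y) * dens G r y V))
    (hLMF : ∀ β, β₅ ≤ β → ∀ L : ℕ, Λ₅ ≤ a β * L →
      X ≤ (∫ U, hl β L U.negReflect * hl β L U ∂(wilsonMeasure (d := 4) (L := 2 * L + 1) r.ρ β)) -
        (∫ U, hl β L U.negReflect ∂(wilsonMeasure (d := 4) (L := 2 * L + 1) r.ρ β)) *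
          (∫ U, hl β L U ∂(wilsonMeasure (d := 4) (L := 2 * L + 1) r.ρ β)))
    (hLXB : ∀ β, β₅ ≤ β → ∀ L : ℕ, Λ₅ ≤ a β * L →
      |(∫ U, hl β L U.negReflect *
            (((wilsonMeasure (d := 4) (L := 2 * L + 1) r.ρ β)[fun U =>
                ∑ y ∈ cubeSites (c β) (b β), v (a β • siteToE y) * dens G r y (torusLift (2 * L + 1) U)|
                MeasurableSpace.comap (π β L) inferInstance]) U - hl β L U)
            ∂(wilsonMeasure (d := 4) (L := 2 * L + 1) r.ρ β)) -
          (∫ U, hl β L U.negReflect ∂(wilsonMeasure (d := 4) (L := 2 * L + 1) r.ρ β)) *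
            (∫ U, (((wilsonMeasure (d := 4) (L := 2 * L + 1) r.ρ β)[fun U =>
                ∑ y ∈ cubeSites (c β) (b β), v (a β • siteToE y) * dens G r y (torusLift (2 * L + 1) U)|
                MeasurableSpace.comap (π β L) inferInstance]) U - hl β L U)
              ∂(wilsonMeasure (d := 4) (L := 2 * L + 1) r.ρ β))| ≤ ρ) :
    ∃ (v : 𝓢(EuclideanSpace ℝ (Fin 4), ℝ)) (ε β₅ Λ₅ : ℝ),
      HasCompactSupport (v : EuclideanSpace ℝ (Fin 4) → ℝ) ∧
      tsupport (v : EuclideanSpace ℝ (Fin 4) → ℝ) ⊆ {y : EuclideanSpace ℝ (Fin 4) | 0 < y 0} ∧ 0 < ε ∧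
      ∀ β : ℝ, β₅ ≤ β → ∀ L : ℕ, Λ₅ ≤ a β * L → ε ≤ Q2 G r β L (a β) (thetaTest 4 v) v :=
  ⟨v, ε, max (max β₅ 0) 0, Λ₅, hvK, hv, hε,
    Q2_floor_of_localisedMirror G r a ha₀ v hε hbud c b p' hgeom hsupp hΔ π θ hπ hl hloc hLMF hLXB⟩

end General

/-! ## §2 The REGISTERED `stub_floorsEngine` statement at `(SU(2), rF)` from {BL6, localised mirror, clause (ii)} -/

open Summit.QuantumFields.YangMills.Cruxes.UVSeamRec.MarkovMirrorFloors (stubFloorsEngine_of_bareFloor_rF)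

/-- **CHECK-LEMMA: the REGISTERED v5(α)/v4-F `UVSeamRec.stub_floorsEngine` statement from the localised-mirror
package at `rF`.**  For `SU(2)` with its Borel σ-algebra: a unit map `a > 0` with `a β / uRec β → c₀ > 0`; ONE
compactly supported positive-time `v`, `ε > 0`, `κ > 0`, `C₁ ≥ 0`, constants `X, ρ` with `4ε + 2ρ ≤ X`; per coupling
`β ≥ β₅` a positive-time cube `Q_β` of physical size `≤ Λ₅` carrying the lattice support of `v(aβ·)` at depth `≥ 2`
and its `e₀`-thickening at physical depth `≥ κ`; (BL6) the one-plaquette boundary law `C₁/depth⁴` on the thickened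
support for every exterior; per coupling and torus a `Θ'`-EQUIVARIANT measurable coarse-graining `π β L` (block
field; its target type `Y β L` and reflection `θ β L` are data of the package) and a LOCALISER `hl β L`
(`σ(π β L)`-measurable, bounded, positive-half, centred on `Ṽ_v`) with (LMF) `X ≤ Cov_T(hl∘Θ', hl)` and (LXB)
`|Cov_T(hl∘Θ', g − hl)| ≤ ρ`, `g = E_T[Ṽ_v∘lift | σ(π β L)]`, on every torus `aβ·L ≥ Λ₅`; and any supplier of the
compact-witness three-point conjunct.  Then the statement of `stub_floorsEngine` holds —
`MarkovMirrorFloors.stubFloorsEngine_of_bareFloor_rF` (p518416) with its (MF) conjunct discharged by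
`bareFloors_of_localisedMirror` (restricting to `β ≥ max β₅ 0` for reflection positivity).
[cite: OsterwalderSeiler1978, §2] -/
theorem stubFloorsEngine_of_localisedMirror_rF
    (h : letI : MeasurableSpace (Matrix.specialUnitaryGroup (Fin 2) ℂ) := borel _
      haveI : BorelSpace (Matrix.specialUnitaryGroup (Fin 2) ℂ) := ⟨rfl⟩
      ∃ (a : ℝ → ℝ) (c₀ : ℝ), 0 < c₀ ∧ (∀ β, 0 < a β) ∧
        Tendsto (fun β => a β / Transport.uRec β) atTop (𝓝 c₀) ∧
      (∃ (v : 𝓢(EuclideanSpace ℝ (Fin 4), ℝ)) (ε β₅ Λ₅ κ C₁ : ℝ) (c : ℝ → (Fin 4 → ℤ)) (b : ℝ → ℕ)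
          (p6 : ℝ → {q : Fin 4 × Fin 4 // q.1 < q.2} → ℝ) (X ρ : ℝ)
          (Y : ℝ → ℕ → Type) (_ : ∀ β L, MeasurableSpace (Y β L))
          (π : ∀ (β : ℝ) (L : ℕ), GaugeConfig 4 (2 * L + 1) (Matrix.specialUnitaryGroup (Fin 2) ℂ) → Y β L)
          (θ : ∀ (β : ℝ) (L : ℕ), Y β L → Y β L)
          (hl : ∀ (β : ℝ) (L : ℕ), GaugeConfig 4 (2 * L + 1) (Matrix.specialUnitaryGroup (Fin 2) ℂ) → ℝ),
          HasCompactSupport (v : EuclideanSpace ℝ (Fin 4) → ℝ) ∧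
          tsupport (v : EuclideanSpace ℝ (Fin 4) → ℝ) ⊆ {y | 0 < y 0} ∧ 0 < ε ∧ 0 < κ ∧ 0 ≤ C₁ ∧
          4 * ε + 2 * ρ ≤ X ∧
          (∀ β, β₅ ≤ β → 1 ≤ c β 0 ∧ ∀ j : Fin 4, (|((c β j : ℤ) : ℝ)| + (b β : ℝ) + 3) * a β ≤ Λ₅) ∧
          (∀ β, β₅ ≤ β → ∀ x : Fin 4 → ℤ, v (a β • siteToE x) ≠ 0 →
            x ∈ cubeSites (c β) (b β) ∧ 2 ≤ depth (c β) (b β) x) ∧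
          (∀ β, β₅ ≤ β → ∀ x : Fin 4 → ℤ,
            (v (a β • siteToE x) ≠ 0 ∨ v (a β • siteToE (x + Pi.single 0 1)) ≠ 0) →
              x ∈ cubeSites (c β) (b β) ∧ κ / a β ≤ (depth (c β) (b β) x : ℝ)) ∧
          (∀ β, β₅ ≤ β → ∀ (ζ : LGConfig 4 (Matrix.specialUnitaryGroup (Fin 2) ℂ))
            (q : {q : Fin 4 × Fin 4 // q.1 < q.2}), q.1.1 = 0 → ∀ x ∈ cubeSites (c β) (b β),
              (v (a β • siteToE x) ≠ 0 ∨ v (a β • siteToE (x + Pi.single 0 1)) ≠ 0) →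
                |kerE (Matrix.specialUnitaryGroup (Fin 2) ℂ) (fundamentalLatticeRep 2) β (c β) (b β) ζ
                    (plane (Matrix.specialUnitaryGroup (Fin 2) ℂ) (fundamentalLatticeRep 2) q.1 x) - p6 β q| ≤
                  C₁ / (depth (c β) (b β) x : ℝ) ^ 4) ∧
          (∀ (β : ℝ) (L : ℕ), Measurable (π β L) ∧ Measurable (θ β L) ∧
            ∀ U, π β L (GaugeConfig.negReflect U) = θ β L (π β L U)) ∧
          (∀ β, β₅ ≤ β → ∀ L : ℕ, Λ₅ ≤ a β * L →
            Measurable[MeasurableSpace.comap (π β L) inferInstance] (hl β L) ∧ (∃ K : ℝ, ∀ U, |hl β L U| ≤ K) ∧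
            DependsOn (hl β L) {e : Edge 4 (2 * L + 1) | (e.1 0).val ≤ L ∧ ((e.1.shift e.2) 0).val ≤ L} ∧
            ∫ U, hl β L U ∂(wilsonMeasure (d := 4) (L := 2 * L + 1) (fundamentalLatticeRep 2).ρ β) =
              torusE (Matrix.specialUnitaryGroup (Fin 2) ℂ) (fundamentalLatticeRep 2) β L (fun V =>
                ∑ y ∈ cubeSites (c β) (b β), v (a β • siteToE y) *
                  dens (Matrix.specialUnitaryGroup (Fin 2) ℂ) (fundamentalLatticeRep 2) y V)) ∧
          (∀ β, β₅ ≤ β → ∀ L : ℕ, Λ₅ ≤ a β * L →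
            X ≤ (∫ U, hl β L U.negReflect * hl β L U
                  ∂(wilsonMeasure (d := 4) (L := 2 * L + 1) (fundamentalLatticeRep 2).ρ β)) -
              (∫ U, hl β L U.negReflect ∂(wilsonMeasure (d := 4) (L := 2 * L + 1) (fundamentalLatticeRep 2).ρ β)) *
                (∫ U, hl β L U ∂(wilsonMeasure (d := 4) (L := 2 * L + 1) (fundamentalLatticeRep 2).ρ β))) ∧
          (∀ β, β₅ ≤ β → ∀ L : ℕ, Λ₅ ≤ a β * L →
            |(∫ U, hl β L U.negReflect *
                  (((wilsonMeasure (d := 4) (L := 2 * L + 1) (fundamentalLatticeRep 2).ρ β)[fun U =>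
                      ∑ y ∈ cubeSites (c β) (b β), v (a β • siteToE y) *
                        dens (Matrix.specialUnitaryGroup (Fin 2) ℂ) (fundamentalLatticeRep 2) y
                          (torusLift (2 * L + 1) U)|
                      MeasurableSpace.comap (π β L) inferInstance]) U - hl β L U)
                  ∂(wilsonMeasure (d := 4) (L := 2 * L + 1) (fundamentalLatticeRep 2).ρ β)) -
                (∫ U, hl β L U.negReflect
                    ∂(wilsonMeasure (d := 4) (L := 2 * L + 1) (fundamentalLatticeRep 2).ρ β)) *
                  (∫ U, (((wilsonMeasure (d := 4) (L := 2 * L + 1) (fundamentalLatticeRep 2).ρ β)[fun U =>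
                      ∑ y ∈ cubeSites (c β) (b β), v (a β • siteToE y) *
                        dens (Matrix.specialUnitaryGroup (Fin 2) ℂ) (fundamentalLatticeRep 2) y
                          (torusLift (2 * L + 1) U)|
                      MeasurableSpace.comap (π β L) inferInstance]) U - hl β L U)
                    ∂(wilsonMeasure (d := 4) (L := 2 * L + 1) (fundamentalLatticeRep 2).ρ β))| ≤ ρ)) ∧
      (∃ (f g h : 𝓢(EuclideanSpace ℝ (Fin 4), ℝ)) (ε β₅ Λ₅ : ℝ),
        HasCompactSupport (f : EuclideanSpace ℝ (Fin 4) → ℝ) ∧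
        HasCompactSupport (g : EuclideanSpace ℝ (Fin 4) → ℝ) ∧
        HasCompactSupport (h : EuclideanSpace ℝ (Fin 4) → ℝ) ∧
        Disjoint (tsupport (f : EuclideanSpace ℝ (Fin 4) → ℝ)) (tsupport (g : EuclideanSpace ℝ (Fin 4) → ℝ)) ∧
        Disjoint (tsupport (g : EuclideanSpace ℝ (Fin 4) → ℝ)) (tsupport (h : EuclideanSpace ℝ (Fin 4) → ℝ)) ∧
        Disjoint (tsupport (f : EuclideanSpace ℝ (Fin 4) → ℝ)) (tsupport (h : EuclideanSpace ℝ (Fin 4) → ℝ)) ∧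
        0 < ε ∧ ∀ β : ℝ, β₅ ≤ β → ∀ L : ℕ, Λ₅ ≤ a β * L →
          ε ≤ |Q3 (Matrix.specialUnitaryGroup (Fin 2) ℂ) (fundamentalLatticeRep 2) β L (a β) f g h|)) :
    letI : MeasurableSpace (Matrix.specialUnitaryGroup (Fin 2) ℂ) := borel _
    haveI : BorelSpace (Matrix.specialUnitaryGroup (Fin 2) ℂ) := ⟨rfl⟩
    ∃ (a : ℝ → ℝ) (c₀ : ℝ), 0 < c₀ ∧ (∀ β, 0 < a β) ∧
      Tendsto (fun β => a β / Transport.uRec β) atTop (𝓝 c₀) ∧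
      (∃ (v : 𝓢(EuclideanSpace ℝ (Fin 4), ℝ)) (ε β₅ Λ₅ : ℝ),
        HasCompactSupport (v : EuclideanSpace ℝ (Fin 4) → ℝ) ∧
        tsupport (v : EuclideanSpace ℝ (Fin 4) → ℝ) ⊆ {y : EuclideanSpace ℝ (Fin 4) | 0 < y 0} ∧ 0 < ε ∧
        ∀ β : ℝ, β₅ ≤ β → ∀ L : ℕ, Λ₅ ≤ a β * L →
          ε ≤ Q2 (Matrix.specialUnitaryGroup (Fin 2) ℂ) (fundamentalLatticeRep 2) β L (a β) (thetaTest 4 v) v) ∧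
      (∃ (f g h : 𝓢(EuclideanSpace ℝ (Fin 4), ℝ)) (ε β₅ Λ₅ : ℝ),
        HasCompactSupport (f : EuclideanSpace ℝ (Fin 4) → ℝ) ∧
        HasCompactSupport (g : EuclideanSpace ℝ (Fin 4) → ℝ) ∧
        HasCompactSupport (h : EuclideanSpace ℝ (Fin 4) → ℝ) ∧
        Disjoint (tsupport (f : EuclideanSpace ℝ (Fin 4) → ℝ)) (tsupport (g : EuclideanSpace ℝ (Fin 4) → ℝ)) ∧
        Disjoint (tsupport (g : EuclideanSpace ℝ (Fin 4) → ℝ)) (tsupport (h : EuclideanSpace ℝ (Fin 4) → ℝ)) ∧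
        Disjoint (tsupport (f : EuclideanSpace ℝ (Fin 4) → ℝ)) (tsupport (h : EuclideanSpace ℝ (Fin 4) → ℝ)) ∧
        0 < ε ∧ ∀ β : ℝ, β₅ ≤ β → ∀ L : ℕ, Λ₅ ≤ a β * L →
          ε ≤ |Q3 (Matrix.specialUnitaryGroup (Fin 2) ℂ) (fundamentalLatticeRep 2) β L (a β) f g h|) := by
  letI : MeasurableSpace (Matrix.specialUnitaryGroup (Fin 2) ℂ) := borel _
  haveI : BorelSpace (Matrix.specialUnitaryGroup (Fin 2) ℂ) := ⟨rfl⟩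
  obtain ⟨a, c₀, hc₀, ha₀, hau, ⟨v, ε, β₅, Λ₅, κ, C₁, c, b, p6, X, ρ, Y, instY, π, θ, hl, hvK, hv, hε, hκ, hC₁, hbud,
    hgeom, hsupp, hthick, hBL, hπ, hloc, hLMF, hLXB⟩, h3⟩ := h
  have hMF := bareFloors_of_localisedMirror (Matrix.specialUnitaryGroup (Fin 2) ℂ) (fundamentalLatticeRep 2) a ha₀
    hbud c b (fun β y => v (a β • siteToE y)) hgeom π θ hπ hl hloc hLMF hLXB
  exact stubFloorsEngine_of_bareFloor_rF ⟨a, c₀, hc₀, ha₀, hau, ⟨v, ε, max β₅ 0, Λ₅, κ, C₁, c, b, p6, hvK, hv,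
    hε, hκ, hC₁, fun β hβ => hgeom β (le_of_max_le_left hβ), fun β hβ => hsupp β (le_of_max_le_left hβ),
    fun β hβ => hthick β (le_of_max_le_left hβ), fun β hβ => hBL β (le_of_max_le_left hβ), hMF⟩, h3⟩

end Summit.QuantumFields.YangMills.Cruxes.UVSeamRec.MirrorSplitFloors

end
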